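import Literature.NumberTheory.Weil1964.ArchCovariantSchur
import Literature.NumberTheory.Weil1964.ArchMetaplecticExtension
import HarnessLib

/-!
# The archimedean phase map of an adelic symplectic element is a symplectic linear automorphism of `ℝ^σ × ℝ^σ`

Topic `NumberTheory/Weil1964`; namespace `Literature.NumberTheory.Weil1964`.  KERNEL MATHEMATICS ONLY: explicit
definitions with body (`archTrace`, `archPhaseLin`, `archPhaseSp`) and proved theorems; no `def … : Prop` record, no
axiom, no proof hole.

For `g ∈ Sp(W_𝔸)` (`W_𝔸 = 𝔸_F^ι × 𝔸_F^ι`, form `polar (adelicForm F ι T)`, archimedean part `T_∞` of `T` invertible) and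
a real frame `e : (F ⊗ ℝ)^ι ≃L ℝ^σ`, the tree's `archPhaseMap T e hT g = Ξ_e ∘ archAct g ∘ Ξ_e⁻¹` (`ArchFollandCoordinates`;
`Ξ_e (a, w) = (e a, follandFreq e (T_∞ w))`) is so far only a FUNCTION of `ℝ^σ × ℝ^σ`.  This file proves that it is a
REAL-LINEAR SYMPLECTIC automorphism for the standard form `polar (dotPairing σ)`:

* `archAct_add`, `archAct_smul` — `archAct g` is `ℝ`-linear (the `𝔸_F`-linear `g` preserves the archimedean vectors,
  `apply_archVec_pair`; real scalars act through the archimedean idele `(c, 0)`);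
* `archFolland_add`, `archFolland_smul` — `Ξ_e` is `ℝ`-linear;
* `archTrace_adelicForm_archVec` — the real trace of the adelic form on archimedean vectors is the trace pairing
  `⟨a, T_∞ w⟩_{Tr}`, so that (`apply_dotProduct_follandFreq`) `Ξ_e` carries `−Tr_{F_∞/ℝ} ∘ polar(T_∞)` to the standard
  polarised form: **`archPhaseMap` preserves the standard symplectic form** (`archPhaseMap_symplectic`);
* **`archPhaseLin T e hT g : (ℝ^σ × ℝ^σ) ≃ₗ[ℝ] (ℝ^σ × ℝ^σ)`** with `⇑ = archPhaseMap T e hT g`, and the HOMOMORPHISM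
  **`archPhaseSp T e hT : Sp(W_𝔸) →* Sp(ℝ^σ × ℝ^σ)`** (`coe_archPhaseSp`), `archPhaseMap_mul` being multiplicativity.

Consequence used by the archimedean half of the unitary Weil splitting ([GelbartRogawski1991, §3.1]): every
`g ∈ Sp(W_𝔸)` — in particular Weil's rational elements `r_F(γ)`, e.g. Li's `δ` of the doubling method — has a
metaplectic implementer `z ∈ Mp^𝓢(ℝ^σ)` over its archimedean phase map (`exists_MpS_over_archPhaseMap`, from
`MpS.exists_implementerS`).

## References

* [Weil1964] A. Weil, Acta Math. 111 (1964), Chap. I n° 5 p. 150 (`σ` symplectic), Chap. III n° 37–38 pp. 188–190.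
* [Folland1989] G. B. Folland, *Harmonic Analysis in Phase Space*, Princeton UP 1989, Prop. (1.43), §4.1 Prop. (4.10).
* [GelbartRogawski1991] S. Gelbart, J. Rogawski, Invent. math. 105 (1991), §3.1 p. 454.
-/

set_option autoImplicit false

noncomputable section

open scoped Matrix
open NumberField NumberField.mixedEmbedding IsDedekindDomain

namespace Literature.NumberTheory.Weil1964

open Literature.Analysis.SegalBargmann Literature.RepresentationTheory.HeisenbergGroup
open Literature.NumberTheory.Automorphic

variable {F : Type} [Field F] [NumberField F] {ι : Type} [Fintype ι] [DecidableEq ι]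
  (T : Matrix ι ι (AdeleRing (𝓞 F) F))

/-! ## §1 Real scalars act on archimedean vectors through the archimedean adele `(c, 0)` -/

variable (F) in
/-- the archimedean adele `(c · 1_∞, 0) ∈ 𝔸_F` of a real scalar `c`. [cite: Weil1964, Chap. III n° 37 p. 188] -/
def realAdele (c : ℝ) : AdeleRing (𝓞 F) F :=
  infiniteAdeleInl F ((InfiniteAdeleRing.ringEquiv_mixedSpace F).symm (c • (1 : mixedSpace F)))

omit [Fintype ι] [DecidableEq ι] in
/-- `archVec (c • a) = (c, 0) • archVec a`. [cite: Weil1964, Chap. III n° 37 p. 188] -/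
theorem archVec_smul (c : ℝ) (a : ι → mixedSpace F) : archVec F ι (c • a) = realAdele F c • archVec F ι a := by
  funext i
  have h1 : (realAdele F c).1 = (InfiniteAdeleRing.ringEquiv_mixedSpace F).symm (c • (1 : mixedSpace F)) := rfl
  rw [Pi.smul_apply (realAdele F c), smul_eq_mul, archVec_apply_eq_infiniteAdeleInl, archVec_apply_eq_infiniteAdeleInl,
    mul_infiniteAdeleInl, h1, ← map_mul, Pi.smul_apply, smul_one_mul]

omit [Fintype ι] [DecidableEq ι] in
/-- `piArch ((c, 0) • v) = c • piArch v`. [cite: Weil1964, Chap. III n° 37 p. 188] -/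
theorem piArch_realAdele_smul (c : ℝ) (v : ι → AdeleRing (𝓞 F) F) :
    piArch F ι (realAdele F c • v) = c • piArch F ι v := by
  funext i
  have h1 : (realAdele F c).1 = (InfiniteAdeleRing.ringEquiv_mixedSpace F).symm (c • (1 : mixedSpace F)) := rfl
  have h2 : ((realAdele F c • v) i).1 = (realAdele F c).1 * (v i).1 := rfl
  rw [piArch_apply, Pi.smul_apply c, piArch_apply, h2, map_mul, h1, RingEquiv.apply_symm_apply, smul_one_mul]

/-! ## §2 `archAct g` and `Ξ_e` are real-linear -/

/-- `archAct g` is additive. [cite: Weil1964, Chap. I n° 5 p. 150] -/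
theorem archAct_add (g : symplecticGroup (polar (adelicForm F ι T)))
    (aw aw' : (ι → mixedSpace F) × (ι → mixedSpace F)) : archAct T g (aw + aw') = archAct T g aw + archAct T g aw' := by
  obtain ⟨a, w⟩ := aw
  obtain ⟨a', w'⟩ := aw'
  simp only [archAct, Prod.mk_add_mk, archVec_add]
  rw [← Prod.mk_add_mk, map_add, Prod.fst_add, Prod.snd_add, piArch_add, piArch_add]

/-- `archAct g` commutes with real scalars. [cite: Weil1964, Chap. I n° 5 p. 150] -/
theorem archAct_smul (g : symplecticGroup (polar (adelicForm F ι T))) (c : ℝ)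
    (aw : (ι → mixedSpace F) × (ι → mixedSpace F)) : archAct T g (c • aw) = c • archAct T g aw := by
  obtain ⟨a, w⟩ := aw
  simp only [archAct, Prod.smul_mk, archVec_smul]
  rw [← Prod.smul_mk, map_smul, Prod.smul_fst, Prod.smul_snd, piArch_realAdele_smul, piArch_realAdele_smul]

variable {σ : Type*} [Fintype σ] (e : (ι → mixedSpace F) ≃L[ℝ] (σ → ℝ))

omit [DecidableEq ι] [Fintype σ] in
/-- `Ξ_e` is additive. [cite: Folland1989, Prop. (1.43)] -/
theorem archFolland_add (aw aw' : (ι → mixedSpace F) × (ι → mixedSpace F)) :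
    archFolland T e (aw + aw') = archFolland T e aw + archFolland T e aw' := by
  obtain ⟨a, w⟩ := aw
  obtain ⟨a', w'⟩ := aw'
  rw [Prod.mk_add_mk, archFolland_apply, archFolland_apply, archFolland_apply, Prod.mk_add_mk, map_add,
    Matrix.mulVec_add, follandFreq_add]

omit [DecidableEq ι] [Fintype σ] in
/-- `Ξ_e` commutes with real scalars. [cite: Folland1989, Prop. (1.43)] -/
theorem archFolland_smul (c : ℝ) (aw : (ι → mixedSpace F) × (ι → mixedSpace F)) :
    archFolland T e (c • aw) = c • archFolland T e aw := by
  obtain ⟨a, w⟩ := aw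
  rw [Prod.smul_mk, archFolland_apply, archFolland_apply, Prod.smul_mk, map_smul, Matrix.mulVec_smul,
    ← follandFreqₗ_apply, map_smul, follandFreqₗ_apply]

variable (hT : IsUnit (archMat F ι T))

/-- `archPhaseMap g` is additive. [cite: Folland1989, §4.1 Prop. (4.10)] -/
theorem archPhaseMap_add (g : symplecticGroup (polar (adelicForm F ι T))) (pq pq' : (σ → ℝ) × (σ → ℝ)) :
    archPhaseMap T e hT g (pq + pq') = archPhaseMap T e hT g pq + archPhaseMap T e hT g pq' := by
  obtain ⟨aw, rfl⟩ := (archFolland_bijective T e hT).2 pq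
  obtain ⟨aw', rfl⟩ := (archFolland_bijective T e hT).2 pq'
  rw [← archFolland_add, archPhaseMap_archFolland, archPhaseMap_archFolland, archPhaseMap_archFolland, archAct_add,
    archFolland_add]

/-- `archPhaseMap g` commutes with real scalars. [cite: Folland1989, §4.1 Prop. (4.10)] -/
theorem archPhaseMap_smul (g : symplecticGroup (polar (adelicForm F ι T))) (c : ℝ) (pq : (σ → ℝ) × (σ → ℝ)) :
    archPhaseMap T e hT g (c • pq) = c • archPhaseMap T e hT g pq := by
  obtain ⟨aw, rfl⟩ := (archFolland_bijective T e hT).2 pq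
  rw [← archFolland_smul, archPhaseMap_archFolland, archPhaseMap_archFolland, archAct_smul, archFolland_smul]

/-- `archPhaseMap 1 = id`. [cite: Folland1989, §4.1 Prop. (4.10)] -/
theorem archPhaseMap_one (pq : (σ → ℝ) × (σ → ℝ)) : archPhaseMap T e hT 1 pq = pq := by
  rw [archPhaseMap, archAct_one, archFolland_archFollandInv]

/-- **`archPhaseLin T e hT g`**: the archimedean phase map of `g` as a real-linear automorphism of `ℝ^σ × ℝ^σ`
(inverse: the phase map of `g⁻¹`). [cite: Folland1989, §4.1 Prop. (4.10); Weil1964, Chap. I n° 5 p. 150] -/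
def archPhaseLin (g : symplecticGroup (polar (adelicForm F ι T))) : ((σ → ℝ) × (σ → ℝ)) ≃ₗ[ℝ] ((σ → ℝ) × (σ → ℝ)) where
  toFun := archPhaseMap T e hT g
  invFun := archPhaseMap T e hT g⁻¹
  map_add' := archPhaseMap_add T e hT g
  map_smul' := archPhaseMap_smul T e hT g
  left_inv pq := by rw [← archPhaseMap_mul, inv_mul_cancel, archPhaseMap_one]
  right_inv pq := by rw [← archPhaseMap_mul, mul_inv_cancel, archPhaseMap_one]

/-- Unfolding. [cite: Folland1989, §4.1 Prop. (4.10)] -/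
@[simp] theorem coe_archPhaseLin (g : symplecticGroup (polar (adelicForm F ι T))) :
    ⇑(archPhaseLin T e hT g) = archPhaseMap T e hT g := rfl

/-! ## §3 The real trace of the adelic form on archimedean vectors; symplecticity -/

variable (F) in
/-- the real trace `Tr_{F_∞/ℝ}` of the archimedean component of an adele. [cite: Weil1964, Chap. III n° 38 p. 189] -/
def archTrace : AdeleRing (𝓞 F) F →+ ℝ where
  toFun u := mixedTrace F (InfiniteAdeleRing.ringEquiv_mixedSpace F u.1)
  map_zero' := by rw [show (0 : AdeleRing (𝓞 F) F).1 = 0 from rfl, map_zero, map_zero]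
  map_add' u u' := by rw [show (u + u').1 = u.1 + u'.1 from rfl, map_add, map_add]

/-- **`Tr_∞ (adelicForm T (archVec a) (archVec w)) = ⟨a, T_∞ w⟩_{Tr}`**. [cite: Weil1964, Chap. III n° 38 p. 189] -/
theorem archTrace_adelicForm_archVec (a w : ι → mixedSpace F) :
    archTrace F (adelicForm F ι T (archVec F ι a) (archVec F ι w)) = piTracePairing F ι a (archMat F ι T *ᵥ w) := by
  rw [adelicForm_apply, mulVec_archVec, archVec_dotProduct_archVec, infiniteAdeleInl_apply]
  show mixedTrace F (InfiniteAdeleRing.ringEquiv_mixedSpace F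
    ((InfiniteAdeleRing.ringEquiv_mixedSpace F).symm (∑ i, a i * (archMat F ι T *ᵥ w) i))) = _
  rw [RingEquiv.apply_symm_apply, map_sum, piTracePairing_apply]

/-- the real trace of the adelic form at the `g`-image of two archimedean pairs. [cite: Weil1964, Chap. I n° 5 p. 150] -/
theorem archTrace_adelicForm_apply_archVec (g : symplecticGroup (polar (adelicForm F ι T)))
    (a w a' w' : ι → mixedSpace F) :
    archTrace F (polar (adelicForm F ι T) (g.1 (archVec F ι a, archVec F ι w)) (g.1 (archVec F ι a', archVec F ι w'))) =
      piTracePairing F ι (archAct T g (a, w)).1 (archMat F ι T *ᵥ (archAct T g (a', w')).2) := by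
  rw [apply_archVec_pair T g a w, apply_archVec_pair T g a' w', polar_apply]
  exact archTrace_adelicForm_archVec T _ _

omit [DecidableEq ι] in
/-- the standard polarised form in Folland coordinates: `(Ξ(a,w)).1 · (Ξ(a',w')).2 = −⟨a, T_∞ w'⟩_{Tr}`.
[cite: Folland1989, Prop. (1.43)] -/
theorem polar_dotPairing_archFolland (aw aw' : (ι → mixedSpace F) × (ι → mixedSpace F)) :
    polar (dotPairing σ) (archFolland T e aw) (archFolland T e aw') =
      -(piTracePairing F ι aw.1 (archMat F ι T *ᵥ aw'.2)) := by
  rw [polar_apply, archFolland_fst, archFolland_snd]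
  exact apply_dotProduct_follandFreq e aw.1 (archMat F ι T *ᵥ aw'.2)

/-- **`archPhaseMap g` PRESERVES THE STANDARD SYMPLECTIC FORM** of `ℝ^σ × ℝ^σ`: the real trace of the adelic
symplecticity of `g` on archimedean vectors. [cite: Weil1964, Chap. I n° 5 p. 150; Folland1989, Prop. (1.43)] -/
theorem archPhaseMap_symplectic (g : symplecticGroup (polar (adelicForm F ι T))) (pq pq' : (σ → ℝ) × (σ → ℝ)) :
    polar (dotPairing σ) (archPhaseMap T e hT g pq) (archPhaseMap T e hT g pq') -
        polar (dotPairing σ) (archPhaseMap T e hT g pq') (archPhaseMap T e hT g pq) =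
      polar (dotPairing σ) pq pq' - polar (dotPairing σ) pq' pq := by
  obtain ⟨⟨a, w⟩, rfl⟩ := (archFolland_bijective T e hT).2 pq
  obtain ⟨⟨a', w'⟩, rfl⟩ := (archFolland_bijective T e hT).2 pq'
  rw [archPhaseMap_archFolland, archPhaseMap_archFolland, polar_dotPairing_archFolland, polar_dotPairing_archFolland,
    polar_dotPairing_archFolland, polar_dotPairing_archFolland]
  have hg := (mem_symplecticGroup (polar (adelicForm F ι T)) g.1).1 g.2 (archVec F ι a, archVec F ι w)
    (archVec F ι a', archVec F ι w')
  have h := congrArg (archTrace F) hg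
  rw [map_sub, map_sub, archTrace_adelicForm_apply_archVec, archTrace_adelicForm_apply_archVec, polar_apply,
    polar_apply, archTrace_adelicForm_archVec, archTrace_adelicForm_archVec] at h
  simp only at h ⊢
  linarith

/-- `archPhaseLin g` lies in `Sp(ℝ^σ × ℝ^σ)`. [cite: Weil1964, Chap. I n° 5 p. 150] -/
theorem archPhaseLin_mem (g : symplecticGroup (polar (adelicForm F ι T))) :
    archPhaseLin T e hT g ∈ symplecticGroup (polar (dotPairing σ)) := by
  rw [mem_symplecticGroup]
  exact archPhaseMap_symplectic T e hT g

/-- **`archPhaseSp T e hT : Sp(W_𝔸) →* Sp(ℝ^σ × ℝ^σ)`**, `g ↦` its archimedean phase map in the frame `e`.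
[cite: Weil1964, Chap. I n° 5 p. 150, Chap. III n° 37–38; Folland1989, §4.1 Prop. (4.10)] -/
def archPhaseSp : symplecticGroup (polar (adelicForm F ι T)) →* symplecticGroup (polar (dotPairing σ)) where
  toFun g := ⟨archPhaseLin T e hT g, archPhaseLin_mem T e hT g⟩
  map_one' := Subtype.ext (LinearEquiv.ext fun pq => by
    rw [coe_archPhaseLin, archPhaseMap_one]; rfl)
  map_mul' g g' := Subtype.ext (LinearEquiv.ext fun pq => by
    rw [coe_archPhaseLin, archPhaseMap_mul]; rfl)

/-- **`⇑(archPhaseSp g) = archPhaseMap g`.** [cite: Folland1989, §4.1 Prop. (4.10)] -/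
@[simp] theorem coe_archPhaseSp (g : symplecticGroup (polar (adelicForm F ι T))) :
    (⇑((archPhaseSp T e hT g).1 : ((σ → ℝ) × (σ → ℝ)) ≃ₗ[ℝ] ((σ → ℝ) × (σ → ℝ))) :
      ((σ → ℝ) × (σ → ℝ)) → ((σ → ℝ) × (σ → ℝ))) = archPhaseMap T e hT g := rfl

variable [DecidableEq σ]

/-- **every `g ∈ Sp(W_𝔸)` has a metaplectic implementer over its archimedean phase map**: `∃ z ∈ Mp^𝓢(ℝ^σ)`,
`⇑(proj z) = archPhaseMap T e hT g`. [cite: Folland1989, §4.2 (4.23); Weil1964, Chap. III n° 38 p. 189] -/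
theorem exists_MpS_over_archPhaseMap (g : symplecticGroup (polar (adelicForm F ι T))) :
    ∃ z : MpS σ, (⇑((MpS.proj z).1 : ((σ → ℝ) × (σ → ℝ)) ≃ₗ[ℝ] ((σ → ℝ) × (σ → ℝ))) :
      ((σ → ℝ) × (σ → ℝ)) → ((σ → ℝ) × (σ → ℝ))) = archPhaseMap T e hT g := by
  obtain ⟨z, hz⟩ := MpS.proj_surjective (archPhaseSp T e hT g)
  exact ⟨z, by rw [hz, coe_archPhaseSp]⟩

end Literature.NumberTheory.Weil1964

end
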